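/-
Copyright (c) 2026 the pub-hodgecm-mathlib formalisation cell (harness21).  Prover seat hodgecm-mathlib-F0P2-p09 (g3), Track B «K2-LIT» helper hand,
#184♮ = hLiu418 = `stmt-HodgeConjecture-24832`; socket #41, KIND W, (iii-fin) letter (R) = (KW-fin-stab) «quantitative radius-stability»: the Φ5-TIE TWIN + TRANSLATE
LAYER of the (R) pole (KW desk F0P2-p08 (g4) RE-CUT 2026-09-05T01:23:54Z; architect K2E3-p06 (g7); LEAD F0P6-plan (g15) BATCH #215∕#227).
THEOREMS ONLY (no `def`, no `instance`, no notation, no named-fact hypothesis, no `sorry`).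
-/
import Summits.HodgeConjecture.HodgeConjecture.Theorems.K2LiuBadPlaceWhittakerRightTranslate   -- ★ p863711 (+ ★ Φ5-tie `K2LiuBadPlaceWhittakerEntire`, ★ F4b-2 heads, ★ F3b, ★ B3 trace, Tate's `ψ_{F,v}`)
import Literature.NumberTheory.Automorphic.GLnCongruenceSubgroups                           -- ★ `congruenceGL` (the principal levels `K_w(γ)`)
import HarnessLib

/-!
# Crux `HLiu418`, socket #41, (KW-fin-stab) — `K2LiuBadPlaceWhittakerBallLevel`: KAREL'S LEMMA FOR A RIGHT-TRANSLATED FAMILY WITH AN EXPLICIT RADIUS —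
# the ball integrals `∫_{B(−k)} f s (w_Δ n(t) x)·ψ_v(−Tr tr(β t)) dμ` are CONSTANT for `k ≥ R − 1` and ENTIRE in `s`, `R` = a BY-VALUE far-shell radius

Cell `hodgecm-mathlib`, crux item hLiu418 = `stmt-HodgeConjecture-24832` (helper lane `--supports … --as helper`, count-neutral), route of record `HCCMUnconditional`;
squad K2 ∕ K2Liu (L1, LEAD F0P6-plan (g15)), road `K2_Liu`, socket #41, KIND W, (iii-fin) letter (R) `hstab` of ★ p863720 `K2LiuKindWFiniteSizeLetterOfPlace.hsizeLoc_of_place`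
(the radius must be AFFINE IN THE LEVEL EXPONENT; K2E3-p06 (g7)'s census 01:18:40Z).  The (R) pole is cut in three (KW desk 01:23:54Z): FILE 1 ★-cand `K2LiuLocalLeviSupplyLevel`
(Levi elements of principal level, K2E3-p06), FILE 2 `K2LiuBadPlaceWhittakerFarShellsLevel.setIntegral_farShell_eq_zero_of_level` (★ F4b-1 with the level subgroup in place of an
open `U`; far shells dead for `k ≥ K₀ + Σ_w M_w + 4b + 2b′`, `K₀` free of `M, β, s`; K2E3-p06), and THIS FILE = the Φ5-tie twin over FILE 2's conclusion taken BY VALUE, plus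
★ p863711's right-translate layer made PUBLIC (generic GR91 local frame `(F, E, c, δ, v, n, T₀, JD)`, uniformizer `π` of `F_v`, ★ F3b's balls `B a` and shells `Sh k = B(−k) ∖ B(−k+1)`):
* §1 TRANSLATE LAYER for `x ∈ H(F_v)`: `isLocalSiegelSection_mul_right` (`g ↦ f (g x)` is Siegel, `mul_assoc`); **`mem_iInf_comap_congruenceGL_iff`** — the LEVEL SUBGROUP
  `U_γ := ⨅_{w∣v} comap_{(·)_w} K_w(γ_w) ≤ H(F_v)` has `k ∈ U_γ ↔ ∀ w, (k)_w ∈ congruenceGL (n+n) γ_w` (FILE 2's `hUM`); `mul_right_invariant_of_level` — a principal-level letter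
  `f (g·k·x) = f (g·x)` for `(k)_w ∈ K_w(γ_w)` (★ p863964 §4 `hMinv` shape) IS FILE 2's `hfU` for the translate at `U_γ`; pull-back measurability ∕ bounds ∕ continuity of
  `t ↦ f (w_Δ n(t) x)` (★ F3b);
* §2 **`setIntegral_ball_eq_of_farShell_letter`** — ★ Φ5 `whittaker_setIntegral_ball_eq` :106–:119 VERBATIM over a BY-VALUE far-shell letter `hfar : ∀ s k, R ≤ k → ∫_{Sh k} … = 0`
  (generic `ψ`, `τ`): the ball integrals are constant for `k ≥ R − 1` (★ F4b-2 `setIntegral_ball_eq_of_farShell` + ★ F3b lattice facts);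
* §3 `differentiable_setIntegral_ball_mul_right` — ★ p863711's second half: the translated ball integral is `Differentiable ℂ` (★ Φ5 `differentiable_whittaker`, `hbd` on the
  compact image of the ball);
* §4 HEAD **`whittaker_setIntegral_ball_eq_of_level`** — ★ p863711 `whittaker_ball_letters_rightTranslate`'s conclusion (Tate's `ψ_{F,v} = adeleAddCharAt F v`, `Tr = Algebra.trace`)
  with its `∃ K` REPLACED BY THE EXPLICIT RADIUS `(R − 1)⁺`: `(∀ s (k : ℕ), (R−1)⁺ ≤ k → ∫_{B(−k)} = ∫_{B(−(R−1)⁺)}) ∧ Differentiable ℂ (s ↦ ∫_{B(−(R−1)⁺)})` — the `(hballM)` letter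
  of K2E3-p29 (g3)'s FILE 3 `K2LiuKindWFiniteRadiusStabilityOfLetters.hstab_of_letters` (FILE 2 instance `R := K₀ + Σ_w M_w + 4b + 2b′`).
NO open-level hypothesis `hU`, NO Siegel ∕ `χ_v` ∕ `ε` ∕ `c₂` ∕ `b_T` letters here: those are FILE 2's inputs, supplied by §1 in the one-screen closer
(`obtain ⟨K₀, hK₀⟩ := setIntegral_farShell_eq_zero_of_level … ; exact whittaker_setIntegral_ball_eq_of_level … (hfar := hK₀ …)`).
[Casselman1980, §3] [KudlaRallis1994, §2] [Shimura1997, §18.3–18.4] [PlatonovRapinchuk1994, §5.1] [CasselsFrohlichANT1967, Ch. XV §2.2].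
HONEST LABEL.  Count-neutral helper, closes no socket by itself: `HC_CM` is proved only modulo the 7 printed citations (2 remaining named inputs:
hLiu418 = `stmt-HodgeConjecture-24832`, h413 = `stmt-HodgeConjecture-24833`) until rung 0 closes.

## References
* [Casselman1980] W. Casselman, *The unramified principal series of p-adic groups I*, Compositio Math. 40 (1980): §3 (Karel's lemma: the Whittaker integral of a
  vector of level `K_m` is a compact-ball integral of radius affine in `m`).
* [KudlaRallis1994] S. Kudla, S. Rallis, *A regularized Siegel–Weil formula: the first term identity*, Ann. of Math. 140 (1994): §2.
* [Shimura1997] G. Shimura, *Euler products and Eisenstein series*, CBMS 93 (1997): §18.3–18.4.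
* [PlatonovRapinchuk1994] V. Platonov, A. Rapinchuk, *Algebraic Groups and Number Theory* (1994): §5.1 (principal congruence subgroups).
* [CasselsFrohlichANT1967] J. Tate, in Cassels–Fröhlich (eds.), *Algebraic Number Theory* (1967): Ch. XV §2.2 (local components of `ψ`).
-/

set_option autoImplicit false
-- the mandated namespace repeats the single-problem summit's segment (`HodgeConjecture.HodgeConjecture`)
set_option linter.dupNamespace false

noncomputable section

open scoped Matrix NNReal ENNReal Topology MatrixGroups
open NumberField IsDedekindDomain MeasureTheory Measure Filter Set Metric
open Literature.NumberTheory.Automorphic Literature.NumberTheory.Automorphic.UnitaryGroup Literature.NumberTheory.GaloisRepresentations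
open Literature.NumberTheory.GelbartRogawski1991 Literature.NumberTheory.GelbartRogawski1991.AdaptedBlocks
open Literature.NumberTheory.GelbartRogawski1991.UnitaryDualPair
open Literature.NumberTheory.K2Lit Literature.NumberTheory.K2Lit.LocalSiegelDoubled
open Summit.HodgeConjecture.HodgeConjecture.Cruxes.HLiu418.K2LiuBadPlaceWhittakerHeads (setIntegral_ball_eq_of_farShell)
open Summit.HodgeConjecture.HodgeConjecture.Cruxes.HLiu418.K2LiuSkewLatticeShells (measurableSet_ball ball_antitone measure_ball_ne_top isCompact_ball
  continuous_pullback measurable_pullback exists_bound_pullback_of_isCompact)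
open Summit.HodgeConjecture.HodgeConjecture.Cruxes.HLiu418.K2LiuTateCharacterLocalTrace
open Summit.HodgeConjecture.HodgeConjecture.Cruxes.HLiu418.K2LiuBadPlaceWhittakerEntire (differentiable_whittaker)

namespace Summit.HodgeConjecture.HodgeConjecture.Cruxes.HLiu418.K2LiuBadPlaceWhittakerBallLevel

variable (F : Type) [Field F] [NumberField F] (E : Type) [Field E] [NumberField E] [Algebra F E]
  [Algebra.IsQuadraticExtension F E] (c : E ≃ₐ[F] E)
  {δ : E} (hcδ : c δ = -δ) (hδ : δ ≠ 0) {dd : F} (hd : δ * δ = algebraMap F E dd)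
  (v : HeightOneSpectrum (𝓞 F)) (n : ℕ) {T₀ : Matrix (Fin n) (Fin n) F} (hT₀ : T₀.IsSymm)
  {JD : Matrix (Fin (n + n)) (Fin (n + n)) E} (hJD : JD = (LocalSplitting.gramD F n T₀).map (algebraMap F E))
  {π : v.adicCompletion F} (hπ : Valued.v π = WithZero.exp (-1 : ℤ))

/-! ## §1 The translate layer: `g ↦ f (g·x)` is Siegel, of principal level, with continuous ∕ measurable ∕ bounded pull-back -/

section Translate

/-- **the right translate of a local Siegel section is a local Siegel section** (`f (p·g·x) = χ_s(p)·f (g·x)`, `mul_assoc`). [cite: Shimura1997, §18.3] -/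
theorem isLocalSiegelSection_mul_right {χv : ∀ w : UnitaryGroup.PlacesOver E v, (w.1.adicCompletion E)ˣ →* ℂˣ} {s : ℂ}
    {f : UnitaryGroup.localPi E c (n + n) JD v → ℂ} (hf : IsLocalSiegelSection F E c hcδ hδ hd v n hT₀ hJD χv s f)
    (x : UnitaryGroup.localPi E c (n + n) JD v) :
    IsLocalSiegelSection F E c hcδ hδ hd v n hT₀ hJD χv s (fun g => f (g * x)) := fun p hp g => by
  show f (p * g * x) = _ * f (g * x)
  rw [mul_assoc]
  exact hf p hp (g * x)

omit [Algebra.IsQuadraticExtension F E] in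
/-- **THE LEVEL SUBGROUP `U_γ = ⨅_{w∣v} comap_{(·)_w} K_w(γ_w)` OF `H(F_v)`**: `k ∈ U_γ ↔ ∀ w ∣ v, (k)_w ∈ congruenceGL (n+n) γ_w` — the `U` of a principal-level smoothness
hypothesis `hUM : ∀ k, (∀ w, (k)_w ∈ K_w(γ_w)) → k ∈ U` (direction `.2`). [cite: PlatonovRapinchuk1994, §5.1] -/
theorem mem_iInf_comap_congruenceGL_iff (γ : ∀ w : UnitaryGroup.PlacesOver E v, ValuativeRel.ValueGroupWithZero (w.1.adicCompletion E))
    (k : UnitaryGroup.localPi E c (n + n) JD v) :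
    k ∈ (⨅ w : UnitaryGroup.PlacesOver E v, (congruenceGL (n + n) (γ w)).comap
        ((Pi.evalMonoidHom (fun w' : UnitaryGroup.PlacesOver E v => GL (Fin (n + n)) (w'.1.adicCompletion E)) w).comp
          (UnitaryGroup.localPi E c (n + n) JD v).subtype)) ↔
      ∀ w : UnitaryGroup.PlacesOver E v, (k : UnitaryGroup.LocalGLPi E (n + n) v) w ∈ congruenceGL (n + n) (γ w) := by
  simp only [Subgroup.mem_iInf, Subgroup.mem_comap, MonoidHom.coe_comp, Function.comp_apply, Subgroup.coe_subtype, Pi.evalMonoidHom_apply]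

omit [Algebra.IsQuadraticExtension F E] in
/-- **a principal-level letter for the translate IS right-invariance under `U_γ`**: if `f (g·k·x) = f (g·x)` whenever `(k)_w ∈ K_w(γ_w)` for all `w ∣ v` (the shape of ★ p863964 §4's
conclusion for a right translate by an adelic point of bounded local height), then `g ↦ f (g·x)` is right-`U_γ`-invariant. [cite: Casselman1980, §3] [cite: PlatonovRapinchuk1994, §5.1] -/
theorem mul_right_invariant_of_level {Y : Sort*} (f : UnitaryGroup.localPi E c (n + n) JD v → Y) (x : UnitaryGroup.localPi E c (n + n) JD v)
    (γ : ∀ w : UnitaryGroup.PlacesOver E v, ValuativeRel.ValueGroupWithZero (w.1.adicCompletion E))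
    (hfM : ∀ g k : UnitaryGroup.localPi E c (n + n) JD v,
      (∀ w : UnitaryGroup.PlacesOver E v, (k : UnitaryGroup.LocalGLPi E (n + n) v) w ∈ congruenceGL (n + n) (γ w)) → f (g * k * x) = f (g * x)) :
    ∀ g k : UnitaryGroup.localPi E c (n + n) JD v,
      k ∈ (⨅ w : UnitaryGroup.PlacesOver E v, (congruenceGL (n + n) (γ w)).comap
        ((Pi.evalMonoidHom (fun w' : UnitaryGroup.PlacesOver E v => GL (Fin (n + n)) (w'.1.adicCompletion E)) w).comp
          (UnitaryGroup.localPi E c (n + n) JD v).subtype)) →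
      (fun g => f (g * x)) (g * k) = (fun g => f (g * x)) g := fun g k hk =>
  hfM g k ((mem_iInf_comap_congruenceGL_iff F E c v n γ k).1 hk)

omit [Algebra.IsQuadraticExtension F E] in
include hJD in
/-- the pull-back `t ↦ f (w_Δ n(t) x)` of a continuous `f` along the translated unipotent chart is continuous (★ F3b `continuous_pullback` for `g ↦ f (g·x)`).
[cite: Casselman1980, §3] -/
theorem continuous_pullback_mul_right (S : AddSubgroup (Matrix (Fin n) (Fin n) (LocalRing E v)))
    (hS : ∀ t, t ∈ S ↔ (t.map (conjLocal E c v))ᵀ * LocalSplitting.gramS F E v n T₀ + LocalSplitting.gramS F E v n T₀ * t = 0)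
    {X : Type*} [TopologicalSpace X] {f : UnitaryGroup.localPi E c (n + n) JD v → X} (hf : Continuous f) (x : UnitaryGroup.localPi E c (n + n) JD v) :
    Continuous fun t : S => f (LocalSplitting.weylDelta F E c v n hJD * LocalSplitting.nElem F E c v n hJD t.1 ((hS t.1).1 t.2) * x) :=
  continuous_pullback F E c v n hJD S hS (f := fun g => f (g * x)) (hf.comp (continuous_id.mul continuous_const))

omit [Algebra.IsQuadraticExtension F E] in
include hJD in
/-- measurability of the translated pull-back (= ★ F4b-1's `hφm` for `g ↦ f (g·x)`). [cite: Casselman1980, §3] -/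
theorem measurable_pullback_mul_right (S : AddSubgroup (Matrix (Fin n) (Fin n) (LocalRing E v)))
    (hS : ∀ t, t ∈ S ↔ (t.map (conjLocal E c v))ᵀ * LocalSplitting.gramS F E v n T₀ + LocalSplitting.gramS F E v n T₀ * t = 0)
    [MeasurableSpace S] [BorelSpace S] {X : Type*} [TopologicalSpace X] [MeasurableSpace X] [BorelSpace X]
    {f : UnitaryGroup.localPi E c (n + n) JD v → X} (hf : Continuous f) (x : UnitaryGroup.localPi E c (n + n) JD v) :
    Measurable fun t : S => f (LocalSplitting.weylDelta F E c v n hJD * LocalSplitting.nElem F E c v n hJD t.1 ((hS t.1).1 t.2) * x) :=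
  measurable_pullback F E c v n hJD S hS (f := fun g => f (g * x)) (hf.comp (continuous_id.mul continuous_const))

omit [Algebra.IsQuadraticExtension F E] in
include hJD in
/-- boundedness of the translated pull-back on a compact set of the Skew carrier (= ★ F4b-1's `hφC` on the compact balls, ★ F3b `isCompact_ball`). [cite: Casselman1980, §3] -/
theorem exists_bound_pullback_mul_right_of_isCompact (S : AddSubgroup (Matrix (Fin n) (Fin n) (LocalRing E v)))
    (hS : ∀ t, t ∈ S ↔ (t.map (conjLocal E c v))ᵀ * LocalSplitting.gramS F E v n T₀ + LocalSplitting.gramS F E v n T₀ * t = 0)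
    {f : UnitaryGroup.localPi E c (n + n) JD v → ℂ} (hf : Continuous f) (x : UnitaryGroup.localPi E c (n + n) JD v) {K : Set S} (hK : IsCompact K) :
    ∃ C : ℝ, ∀ t ∈ K, ‖f (LocalSplitting.weylDelta F E c v n hJD * LocalSplitting.nElem F E c v n hJD t.1 ((hS t.1).1 t.2) * x)‖ ≤ C :=
  exists_bound_pullback_of_isCompact F E c v n hJD S hS (f := fun g => f (g * x)) (hf.comp (continuous_id.mul continuous_const)) hK

end Translate

/-! ## §2 The Φ5-tie twin: a by-value far-shell letter ⇒ the ball integrals are constant beyond the radius -/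

section Tie

omit [Algebra.IsQuadraticExtension F E] in
include hJD hπ in
/-- **KAREL'S LEMMA FROM A FAR-SHELL LETTER, EXPLICIT RADIUS** (★ Φ5 `whittaker_setIntegral_ball_eq` :106–:119 over a BY-VALUE shell letter; generic `ψ`, `τ`).  On ★ F3b's Skew
carrier `S` with an additive Haar measure `μ`: if for a continuous family `f s`, a translate `x`, an index block `β` and a radius `R` the FAR SHELLS are dead —
`∫_{B(−k) ∖ B(−k+1)} f s (w_Δ n(t) x)·ψ(−τ tr(β t)) dμ = 0` for every `s` and every `k ≥ R` — then the ball integrals `∫_{B(−k)} (same)` do not depend on `k ≥ R − 1`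
(★ F4b-2 `setIntegral_ball_eq_of_farShell`; balls measurable, antitone, of finite measure ★ F3b; the pull-back bounded on the compact balls).
[cite: Casselman1980, §3] [cite: KudlaRallis1994, §2] [cite: Shimura1997, §18.3–18.4] -/
theorem setIntegral_ball_eq_of_farShell_letter (S : AddSubgroup (Matrix (Fin n) (Fin n) (LocalRing E v)))
    (hS : ∀ t, t ∈ S ↔ (t.map (conjLocal E c v))ᵀ * LocalSplitting.gramS F E v n T₀ + LocalSplitting.gramS F E v n T₀ * t = 0)
    [MeasurableSpace S] [BorelSpace S] (μ : Measure S) [μ.IsAddHaarMeasure]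
    {f : ℂ → UnitaryGroup.localPi E c (n + n) JD v → ℂ} (hfc : ∀ s, Continuous (f s)) (x : UnitaryGroup.localPi E c (n + n) JD v)
    {ψ : AddChar (v.adicCompletion F) Circle} (hψ : Continuous ψ) {τ : LocalRing E v → v.adicCompletion F} (hτc : Continuous τ)
    (β : Matrix (Fin n) (Fin n) (LocalRing E v)) {R : ℤ}
    (hfar : ∀ (s : ℂ) (k : ℤ), R ≤ k →
      ∫ t in {t : S | ∀ i j (w : UnitaryGroup.PlacesOver E v), Valued.v (t.1 i j w) ≤ Valued.v (UnitaryGroup.toPlace v w π) ^ (-k)} \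
          {t : S | ∀ i j (w : UnitaryGroup.PlacesOver E v), Valued.v (t.1 i j w) ≤ Valued.v (UnitaryGroup.toPlace v w π) ^ (-k + 1)},
        f s (LocalSplitting.weylDelta F E c v n hJD * LocalSplitting.nElem F E c v n hJD t.1 ((hS t.1).1 t.2) * x) *
          ((ψ (-τ (Matrix.trace (β * t.1))) : Circle) : ℂ) ∂μ = 0)
    (s : ℂ) {k : ℤ} (hk : R - 1 ≤ k) :
    ∫ t in {t : S | ∀ i j (w : UnitaryGroup.PlacesOver E v), Valued.v (t.1 i j w) ≤ Valued.v (UnitaryGroup.toPlace v w π) ^ (-k)},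
        f s (LocalSplitting.weylDelta F E c v n hJD * LocalSplitting.nElem F E c v n hJD t.1 ((hS t.1).1 t.2) * x) *
          ((ψ (-τ (Matrix.trace (β * t.1))) : Circle) : ℂ) ∂μ =
      ∫ t in {t : S | ∀ i j (w : UnitaryGroup.PlacesOver E v), Valued.v (t.1 i j w) ≤ Valued.v (UnitaryGroup.toPlace v w π) ^ (-(R - 1))},
        f s (LocalSplitting.weylDelta F E c v n hJD * LocalSplitting.nElem F E c v n hJD t.1 ((hS t.1).1 t.2) * x) *
          ((ψ (-τ (Matrix.trace (β * t.1))) : Circle) : ℂ) ∂μ := by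
  have hχcont : Continuous fun t : S => ((ψ (-τ (Matrix.trace (β * t.1))) : Circle) : ℂ) :=
    continuous_subtype_val.comp (hψ.comp (hτc.comp (continuous_const.matrix_mul continuous_subtype_val).matrix_trace).neg)
  exact setIntegral_ball_eq_of_farShell μ
    (B := fun a : ℤ => {t : S | ∀ i j (w : UnitaryGroup.PlacesOver E v), Valued.v (t.1 i j w) ≤ Valued.v (UnitaryGroup.toPlace v w π) ^ a})
    (fun a => measurableSet_ball F E v hπ n S a) (fun _ _ haa' => ball_antitone F E v hπ n S haa') (fun a => measure_ball_ne_top F E c v hπ n S hS μ a)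
    (φ := fun s (t : S) => f s (LocalSplitting.weylDelta F E c v n hJD * LocalSplitting.nElem F E c v n hJD t.1 ((hS t.1).1 t.2) * x))
    (χ := fun t : S => ((ψ (-τ (Matrix.trace (β * t.1))) : Circle) : ℂ)) (fun s => measurable_pullback_mul_right F E c v n hJD S hS (hfc s) x)
    hχcont.measurable (fun t => by rw [Circle.norm_coe])
    (fun s a => exists_bound_pullback_mul_right_of_isCompact F E c v n hJD S hS (hfc s) x (isCompact_ball F E c v hπ n S hS a))
    (K := R) hfar s hk

end Tie

/-! ## §3 Holomorphy of the translated ball integral -/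

section Holomorphy

omit [Algebra.IsQuadraticExtension F E] in
include hJD hπ in
/-- **THE TRANSLATED BALL INTEGRAL IS ENTIRE** (★ p863711's second half, generic `ψ`, `τ`): for `f s` continuous, `s ↦ f s g` entire for every `g`, and `f` locally-in-`s` uniformly
bounded on compacts (`hbd`, ★ p863711's bytes), `s ↦ ∫_{B a} f s (w_Δ n(t) x)·ψ(−τ tr(β t)) dμ` is `Differentiable ℂ` (★ Φ5 `differentiable_whittaker` for `g ↦ f s (g·x)`, its `hbd`
letter on the compact image of the ball, ★ F3b `isCompact_ball`). [cite: KudlaRallis1994, §2] [cite: Shimura1997, §18.3–18.4] -/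
theorem differentiable_setIntegral_ball_mul_right (S : AddSubgroup (Matrix (Fin n) (Fin n) (LocalRing E v)))
    (hS : ∀ t, t ∈ S ↔ (t.map (conjLocal E c v))ᵀ * LocalSplitting.gramS F E v n T₀ + LocalSplitting.gramS F E v n T₀ * t = 0)
    [MeasurableSpace S] [BorelSpace S] (μ : Measure S) [μ.IsAddHaarMeasure]
    {f : ℂ → UnitaryGroup.localPi E c (n + n) JD v → ℂ} (hfc : ∀ s, Continuous (f s)) (hdiff : ∀ g, Differentiable ℂ fun s => f s g)
    (hbd : ∀ Kc : Set (UnitaryGroup.localPi E c (n + n) JD v), IsCompact Kc → ∀ s₀ : ℂ, ∃ r > 0, ∃ C : ℝ, ∀ s ∈ Metric.ball s₀ r, ∀ g ∈ Kc, ‖f s g‖ ≤ C)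
    (x : UnitaryGroup.localPi E c (n + n) JD v)
    {ψ : AddChar (v.adicCompletion F) Circle} (hψ : Continuous ψ) {τ : LocalRing E v → v.adicCompletion F} (hτc : Continuous τ)
    (β : Matrix (Fin n) (Fin n) (LocalRing E v)) (a : ℤ) :
    Differentiable ℂ fun s : ℂ =>
      ∫ t in {t : S | ∀ i j (w : UnitaryGroup.PlacesOver E v), Valued.v (t.1 i j w) ≤ Valued.v (UnitaryGroup.toPlace v w π) ^ a},
        f s (LocalSplitting.weylDelta F E c v n hJD * LocalSplitting.nElem F E c v n hJD t.1 ((hS t.1).1 t.2) * x) *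
          ((ψ (-τ (Matrix.trace (β * t.1))) : Circle) : ℂ) ∂μ := by
  have hcont : Continuous fun t : S => (fun g => g * x) (LocalSplitting.weylDelta F E c v n hJD * LocalSplitting.nElem F E c v n hJD t.1 ((hS t.1).1 t.2)) :=
    continuous_pullback F E c v n hJD S hS (f := fun g => g * x) (continuous_id.mul continuous_const)
  exact differentiable_whittaker F E c v n hJD hπ S hS μ (f := fun s g => f s (g * x)) (fun s => (hfc s).comp (continuous_id.mul continuous_const))
    (fun g => hdiff (g * x)) a
    (fun s₀ => by
      obtain ⟨r, hr, C, hC⟩ := hbd _ ((isCompact_ball F E c v hπ n S hS a).image hcont) s₀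
      exact ⟨r, hr, C, fun s hs t ht => hC s hs _ ⟨t, ht, rfl⟩⟩)
    hψ hτc β

end Holomorphy

/-! ## §4 HEAD: Karel's lemma with an explicit radius, Tate's `ψ_{F,v}` and the trace — the `(hballM)` letter -/

section Head

include hJD hπ in
/-- **KAREL'S LEMMA FOR A RIGHT-TRANSLATED FAMILY WITH AN EXPLICIT BY-VALUE RADIUS `R` (radius-agnostic form).**  Generic frame `(F, E, c, δ, v, n, T₀, JD)`, Skew carrier `S`
with an additive Haar measure `μ`, Tate's `ψ_{F,v} = adeleAddCharAt F v` and `Tr = Algebra.trace F_v (E ⊗ F_v)` (★ B3).  For a family `f s` — continuous, `s ↦ f s g` entire,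
locally-in-`s` uniformly bounded on compacts (`hbd`) —, an index block `β`, a translate `x ∈ H(F_v)` and a BY-VALUE FAR-SHELL LETTER with radius `R`
(`∫_{B(−k) ∖ B(−k+1)} f s (w_Δ n(t) x)·ψ_{F,v}(−Tr tr(β t)) dμ = 0` for all `s`, all `k ≥ R` — FILE 2 `setIntegral_farShell_eq_zero_of_level`'s conclusion for the translate, where
`R = K₀ + Σ_w M_w + 4b + 2b′` is AFFINE in the principal level exponents `M_w`): (i) for every `s` and every `k ≥ (R − 1)⁺` the ball integral `∫_{B(−k)} (same)` equals the one at
`k = (R − 1)⁺`; (ii) `s ↦ ∫_{B(−(R−1)⁺)} (same)` is `Differentiable ℂ`.  This is ★ p863711 `whittaker_ball_letters_rightTranslate` with `∃ K` replaced by the explicit `(R − 1)⁺`.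
[cite: Casselman1980, §3] [cite: KudlaRallis1994, §2] [cite: Shimura1997, §18.3–18.4] [cite: CasselsFrohlichANT1967, Ch. XV §2.2] -/
theorem whittaker_setIntegral_ball_eq_of_farShell_letter (S : AddSubgroup (Matrix (Fin n) (Fin n) (LocalRing E v)))
    (hS : ∀ t, t ∈ S ↔ (t.map (conjLocal E c v))ᵀ * LocalSplitting.gramS F E v n T₀ + LocalSplitting.gramS F E v n T₀ * t = 0)
    [MeasurableSpace S] [BorelSpace S] (μ : Measure S) [μ.IsAddHaarMeasure]
    {f : ℂ → UnitaryGroup.localPi E c (n + n) JD v → ℂ} (hfc : ∀ s, Continuous (f s)) (hdiff : ∀ g, Differentiable ℂ fun s => f s g)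
    (hbd : ∀ Kc : Set (UnitaryGroup.localPi E c (n + n) JD v), IsCompact Kc → ∀ s₀ : ℂ, ∃ r > 0, ∃ C : ℝ, ∀ s ∈ Metric.ball s₀ r, ∀ g ∈ Kc, ‖f s g‖ ≤ C)
    (β : Matrix (Fin n) (Fin n) (LocalRing E v)) (x : UnitaryGroup.localPi E c (n + n) JD v) {R : ℤ}
    (hfar : ∀ (s : ℂ) (k : ℤ), R ≤ k →
      ∫ t in {t : S | ∀ i j (w : UnitaryGroup.PlacesOver E v), Valued.v (t.1 i j w) ≤ Valued.v (UnitaryGroup.toPlace v w π) ^ (-k)} \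
          {t : S | ∀ i j (w : UnitaryGroup.PlacesOver E v), Valued.v (t.1 i j w) ≤ Valued.v (UnitaryGroup.toPlace v w π) ^ (-k + 1)},
        f s (LocalSplitting.weylDelta F E c v n hJD * LocalSplitting.nElem F E c v n hJD t.1 ((hS t.1).1 t.2) * x) *
          ((adeleAddCharAt F v (-(Algebra.trace (v.adicCompletion F) (LocalRing E v) (Matrix.trace (β * t.1)))) : Circle) : ℂ) ∂μ = 0) :
    (∀ (s : ℂ) (k : ℕ), (R - 1).toNat ≤ k →
        ∫ t in {t : S | ∀ i j (w : UnitaryGroup.PlacesOver E v), Valued.v (t.1 i j w) ≤ Valued.v (UnitaryGroup.toPlace v w π) ^ (-(k : ℤ))},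
          f s (LocalSplitting.weylDelta F E c v n hJD * LocalSplitting.nElem F E c v n hJD t.1 ((hS t.1).1 t.2) * x) *
            ((adeleAddCharAt F v (-(Algebra.trace (v.adicCompletion F) (LocalRing E v) (Matrix.trace (β * t.1)))) : Circle) : ℂ) ∂μ =
        ∫ t in {t : S | ∀ i j (w : UnitaryGroup.PlacesOver E v), Valued.v (t.1 i j w) ≤ Valued.v (UnitaryGroup.toPlace v w π) ^ (-((R - 1).toNat : ℤ))},
          f s (LocalSplitting.weylDelta F E c v n hJD * LocalSplitting.nElem F E c v n hJD t.1 ((hS t.1).1 t.2) * x) *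
            ((adeleAddCharAt F v (-(Algebra.trace (v.adicCompletion F) (LocalRing E v) (Matrix.trace (β * t.1)))) : Circle) : ℂ) ∂μ) ∧
      Differentiable ℂ fun s : ℂ =>
        ∫ t in {t : S | ∀ i j (w : UnitaryGroup.PlacesOver E v), Valued.v (t.1 i j w) ≤ Valued.v (UnitaryGroup.toPlace v w π) ^ (-((R - 1).toNat : ℤ))},
          f s (LocalSplitting.weylDelta F E c v n hJD * LocalSplitting.nElem F E c v n hJD t.1 ((hS t.1).1 t.2) * x) *
            ((adeleAddCharAt F v (-(Algebra.trace (v.adicCompletion F) (LocalRing E v) (Matrix.trace (β * t.1)))) : Circle) : ℂ) ∂μ := by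
  have key := fun s (k : ℤ) (hk : R - 1 ≤ k) =>
    setIntegral_ball_eq_of_farShell_letter F E c v n hJD hπ S hS μ hfc x (continuous_adeleAddCharAt F v)
      (τ := fun z => Algebra.trace (v.adicCompletion F) (LocalRing E v) z) (continuous_algebraTrace_localRing E v) β hfar s hk
  refine ⟨fun s k hk => (key s (k : ℤ) (by omega)).trans (key s ((R - 1).toNat : ℤ) (by omega)).symm, ?_⟩
  exact differentiable_setIntegral_ball_mul_right F E c v n hJD hπ S hS μ hfc hdiff hbd x (continuous_adeleAddCharAt F v)
    (τ := fun z => Algebra.trace (v.adicCompletion F) (LocalRing E v) z) (continuous_algebraTrace_localRing E v) β _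

include hJD hπ in
/-- **KAREL'S LEMMA AT PRINCIPAL LEVEL FOR A RIGHT TRANSLATE — THE `(hballM)` LETTER OF THE (R) POLE (architect K2E3-p06 (g7)'s shape, NOTE #1 2026-09-05T01:33:21Z).**
Generic frame `(F, E, c, δ, v, n, T₀, JD)`; Skew carrier `S`, additive Haar `μ`; Tate's `ψ_{F,v}` and `Tr = Algebra.trace` (★ B3); uniformisers `ϖ_w` of the `E_w`.  INPUT, ALL BY VALUE:
a constant `K₀ : ℤ` together with THE BODY OF ★ p864134 `K2LiuBadPlaceWhittakerFarShellsLevel.setIntegral_farShell_eq_zero_of_level`'s conclusion after its `∃ K₀` (`hfar`: for EVERY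
level vector `M`, EVERY family `f` of local Siegel sections right-invariant under `∏_w K_w(ϖ_w^{M_w})` with measurable ∕ ball-bounded pull-back, EVERY admissible index
`(b, b′, β, β⁻)`, the far shells `Sh k`, `k ≥ K₀ + Σ_w M_w + 4b + 2b′`, are dead — at `ψ := ψ_{F,v}`, `τ := Tr`); a level vector `M`; a family `f` (Siegel `hf`, continuous `hfc`,
entire `hdiff`, locally-in-`s` bounded on compacts `hbd`); a translate `x ∈ H(F_v)` with THE TRANSLATED LEVEL LETTER `hfMx : f s (g·k·x) = f s (g·x)` for `(k)_w ∈ K_w(ϖ_w^{M_w})`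
(★ p863964 §4 `FvT_mul_mul_evalPlace_eq`'s shape, `M = c_L + 2A(h)`); the index letters `hb hb′ h2bT hβs hββ hβ hβinv`.  OUTPUT: with `R := K₀ + Σ_w M_w + 4b + 2b′`,
(i) `∀ s (k : ℕ), (R − 1)⁺ ≤ k → ∫_{B(−k)} f s (w_Δ n(t) x)·ψ_{F,v}(−Tr tr(β t)) dμ = ∫_{B(−(R−1)⁺)} (same)`; (ii) `s ↦ ∫_{B(−(R−1)⁺)} (same)` is `Differentiable ℂ`.  Proof: `hfar` at
`(M, g ↦ f s (g·x))` through §1 (`isLocalSiegelSection_mul_right`, `hfMx`, `measurable_pullback_mul_right`, `exists_bound_pullback_mul_right_of_isCompact` on ★ F3b's compact balls),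
then `whittaker_setIntegral_ball_eq_of_farShell_letter`.  The radius is AFFINE IN THE LEVEL: this is what ★ p863720's `hstab` consumes.
[cite: Casselman1980, §3] [cite: KudlaRallis1994, §2] [cite: Shimura1997, §18.3–18.4] [cite: PlatonovRapinchuk1994, §5.1] -/
theorem whittaker_setIntegral_ball_eq_of_level (S : AddSubgroup (Matrix (Fin n) (Fin n) (LocalRing E v)))
    (hS : ∀ t, t ∈ S ↔ (t.map (conjLocal E c v))ᵀ * LocalSplitting.gramS F E v n T₀ + LocalSplitting.gramS F E v n T₀ * t = 0)
    [MeasurableSpace S] [BorelSpace S] (μ : Measure S) [μ.IsAddHaarMeasure]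
    {χv : ∀ w : UnitaryGroup.PlacesOver E v, (w.1.adicCompletion E)ˣ →* ℂˣ} {bT : ℤ}
    {ϖ : (w : UnitaryGroup.PlacesOver E v) → w.1.adicCompletion E} (K₀ : ℤ)
    -- ★ p864134's conclusion body after `∃ K₀`, at Tate's `ψ_{F,v}` and `τ := Tr` (BY VALUE until the closed head feeds it)
    (hfar : ∀ (M : UnitaryGroup.PlacesOver E v → ℕ) (f : ℂ → UnitaryGroup.localPi E c (n + n) JD v → ℂ),
      (∀ s, IsLocalSiegelSection F E c hcδ hδ hd v n hT₀ hJD χv s (f s)) →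
      (∀ s g (k : UnitaryGroup.localPi E c (n + n) JD v),
        (∀ w : UnitaryGroup.PlacesOver E v, (k : UnitaryGroup.LocalGLPi E (n + n) v) w ∈
          congruenceGL (n + n) (ValuativeRel.valuation (w.1.adicCompletion E) (ϖ w) ^ M w)) → f s (g * k) = f s g) →
      (∀ s, Measurable fun t : S => f s (LocalSplitting.weylDelta F E c v n hJD * LocalSplitting.nElem F E c v n hJD t.1 ((hS t.1).1 t.2))) →
      (∀ s (k : ℤ), ∃ C : ℝ, ∀ t : S, (∀ i j (w : UnitaryGroup.PlacesOver E v), Valued.v (t.1 i j w) ≤ Valued.v (UnitaryGroup.toPlace v w π) ^ (-k)) →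
        ‖f s (LocalSplitting.weylDelta F E c v n hJD * LocalSplitting.nElem F E c v n hJD t.1 ((hS t.1).1 t.2))‖ ≤ C) →
      ∀ (b b' : ℤ) (β βinv : Matrix (Fin n) (Fin n) (LocalRing E v)), 0 ≤ b → 0 ≤ b' → 2 * bT ≤ b →
      (β.map (conjLocal E c v))ᵀ * LocalSplitting.gramS F E v n T₀ + LocalSplitting.gramS F E v n T₀ * β = 0 → β * βinv = 1 →
      (∀ i j (w : UnitaryGroup.PlacesOver E v), Valued.v (β i j w) ≤ Valued.v (UnitaryGroup.toPlace v w π) ^ (-b)) →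
      (∀ i j (w : UnitaryGroup.PlacesOver E v), Valued.v (βinv i j w) ≤ Valued.v (UnitaryGroup.toPlace v w π) ^ (-b')) →
      ∀ k : ℤ, K₀ + (∑ w : UnitaryGroup.PlacesOver E v, (M w : ℤ)) + 4 * b + 2 * b' ≤ k → ∀ s : ℂ,
        ∫ t in {t : S | ∀ i j (w : UnitaryGroup.PlacesOver E v), Valued.v (t.1 i j w) ≤ Valued.v (UnitaryGroup.toPlace v w π) ^ (-k)} \
            {t : S | ∀ i j (w : UnitaryGroup.PlacesOver E v), Valued.v (t.1 i j w) ≤ Valued.v (UnitaryGroup.toPlace v w π) ^ (-k + 1)},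
          f s (LocalSplitting.weylDelta F E c v n hJD * LocalSplitting.nElem F E c v n hJD t.1 ((hS t.1).1 t.2)) *
            ((adeleAddCharAt F v (-(Algebra.trace (v.adicCompletion F) (LocalRing E v) (Matrix.trace (β * t.1)))) : Circle) : ℂ) ∂μ = 0)
    -- the level vector, the family, the translate and its level letter, the regularity letters
    (M : UnitaryGroup.PlacesOver E v → ℕ) {f : ℂ → UnitaryGroup.localPi E c (n + n) JD v → ℂ}
    (hf : ∀ s, IsLocalSiegelSection F E c hcδ hδ hd v n hT₀ hJD χv s (f s)) (x : UnitaryGroup.localPi E c (n + n) JD v)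
    (hfMx : ∀ s g (k : UnitaryGroup.localPi E c (n + n) JD v),
      (∀ w : UnitaryGroup.PlacesOver E v, (k : UnitaryGroup.LocalGLPi E (n + n) v) w ∈
        congruenceGL (n + n) (ValuativeRel.valuation (w.1.adicCompletion E) (ϖ w) ^ M w)) → f s (g * k * x) = f s (g * x))
    (hfc : ∀ s, Continuous (f s)) (hdiff : ∀ g, Differentiable ℂ fun s => f s g)
    (hbd : ∀ Kc : Set (UnitaryGroup.localPi E c (n + n) JD v), IsCompact Kc → ∀ s₀ : ℂ, ∃ r > 0, ∃ C : ℝ, ∀ s ∈ Metric.ball s₀ r, ∀ g ∈ Kc, ‖f s g‖ ≤ C)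
    -- the index letters
    {b b' : ℤ} {β βinv : Matrix (Fin n) (Fin n) (LocalRing E v)} (hb : 0 ≤ b) (hb' : 0 ≤ b') (h2bT : 2 * bT ≤ b)
    (hβs : (β.map (conjLocal E c v))ᵀ * LocalSplitting.gramS F E v n T₀ + LocalSplitting.gramS F E v n T₀ * β = 0) (hββ : β * βinv = 1)
    (hβ : ∀ i j (w : UnitaryGroup.PlacesOver E v), Valued.v (β i j w) ≤ Valued.v (UnitaryGroup.toPlace v w π) ^ (-b))
    (hβinv : ∀ i j (w : UnitaryGroup.PlacesOver E v), Valued.v (βinv i j w) ≤ Valued.v (UnitaryGroup.toPlace v w π) ^ (-b')) :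
    (∀ (s : ℂ) (k : ℕ), (K₀ + (∑ w : UnitaryGroup.PlacesOver E v, (M w : ℤ)) + 4 * b + 2 * b' - 1).toNat ≤ k →
        ∫ t in {t : S | ∀ i j (w : UnitaryGroup.PlacesOver E v), Valued.v (t.1 i j w) ≤ Valued.v (UnitaryGroup.toPlace v w π) ^ (-(k : ℤ))},
          f s (LocalSplitting.weylDelta F E c v n hJD * LocalSplitting.nElem F E c v n hJD t.1 ((hS t.1).1 t.2) * x) *
            ((adeleAddCharAt F v (-(Algebra.trace (v.adicCompletion F) (LocalRing E v) (Matrix.trace (β * t.1)))) : Circle) : ℂ) ∂μ =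
        ∫ t in {t : S | ∀ i j (w : UnitaryGroup.PlacesOver E v), Valued.v (t.1 i j w) ≤
            Valued.v (UnitaryGroup.toPlace v w π) ^ (-((K₀ + (∑ w : UnitaryGroup.PlacesOver E v, (M w : ℤ)) + 4 * b + 2 * b' - 1).toNat : ℤ))},
          f s (LocalSplitting.weylDelta F E c v n hJD * LocalSplitting.nElem F E c v n hJD t.1 ((hS t.1).1 t.2) * x) *
            ((adeleAddCharAt F v (-(Algebra.trace (v.adicCompletion F) (LocalRing E v) (Matrix.trace (β * t.1)))) : Circle) : ℂ) ∂μ) ∧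
      Differentiable ℂ fun s : ℂ =>
        ∫ t in {t : S | ∀ i j (w : UnitaryGroup.PlacesOver E v), Valued.v (t.1 i j w) ≤
            Valued.v (UnitaryGroup.toPlace v w π) ^ (-((K₀ + (∑ w : UnitaryGroup.PlacesOver E v, (M w : ℤ)) + 4 * b + 2 * b' - 1).toNat : ℤ))},
          f s (LocalSplitting.weylDelta F E c v n hJD * LocalSplitting.nElem F E c v n hJD t.1 ((hS t.1).1 t.2) * x) *
            ((adeleAddCharAt F v (-(Algebra.trace (v.adicCompletion F) (LocalRing E v) (Matrix.trace (β * t.1)))) : Circle) : ℂ) ∂μ := by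
  -- the far shells of the TRANSLATED family are dead beyond `K₀ + Σ_w M_w + 4b + 2b′` (§1 feeds `hfar`)
  have hshell : ∀ (s : ℂ) (k : ℤ), K₀ + (∑ w : UnitaryGroup.PlacesOver E v, (M w : ℤ)) + 4 * b + 2 * b' ≤ k →
      ∫ t in {t : S | ∀ i j (w : UnitaryGroup.PlacesOver E v), Valued.v (t.1 i j w) ≤ Valued.v (UnitaryGroup.toPlace v w π) ^ (-k)} \
          {t : S | ∀ i j (w : UnitaryGroup.PlacesOver E v), Valued.v (t.1 i j w) ≤ Valued.v (UnitaryGroup.toPlace v w π) ^ (-k + 1)},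
        f s (LocalSplitting.weylDelta F E c v n hJD * LocalSplitting.nElem F E c v n hJD t.1 ((hS t.1).1 t.2) * x) *
          ((adeleAddCharAt F v (-(Algebra.trace (v.adicCompletion F) (LocalRing E v) (Matrix.trace (β * t.1)))) : Circle) : ℂ) ∂μ = 0 :=
    fun s k hk => hfar M (fun s g => f s (g * x)) (fun s => isLocalSiegelSection_mul_right F E c hcδ hδ hd v n hT₀ hJD (hf s) x)
      (fun s g k hk => hfMx s g k hk) (fun s => measurable_pullback_mul_right F E c v n hJD S hS (hfc s) x)
      (fun s k => by
        obtain ⟨C, hC⟩ := exists_bound_pullback_mul_right_of_isCompact F E c v n hJD S hS (hfc s) x (isCompact_ball F E c v hπ n S hS (-k))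
        exact ⟨C, fun t ht => hC t ht⟩)
      b b' β βinv hb hb' h2bT hβs hββ hβ hβinv k hk s
  exact whittaker_setIntegral_ball_eq_of_farShell_letter F E c v n hJD hπ S hS μ hfc hdiff hbd β x hshell

end Head

end Summit.HodgeConjecture.HodgeConjecture.Cruxes.HLiu418.K2LiuBadPlaceWhittakerBallLevel

end
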